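import Mathlib.Data.Nat.Pairing
import Mathlib.Data.Finset.Sort
import Mathlib.Analysis.SpecialFunctions.Pow.Real
import Literature.Computability.Complexity.CNF
import Literature.Computability.MetaComplexity.Resolution
import Literature.Computability.MetaComplexity.ResolutionRecords
import HarnessLib

/-!
# Refutation-statement CNFs for Resolution: `REF(F,s)`, `RREF(F,s)` and the Atserias–Müller gadget

The *refutation statement* `REF(F,s)` of Pudlák [Pudlák 2003] is the CNF whose satisfying
assignments describe the Resolution refutations of the CNF `F` of length `s` ("`F` has a
Resolution refutation of length `s`", lines encoded in unary). Atserias and Müller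
[Atserias–Müller 2020] give an explicit clause table for `REF(F,s)` (their Appendix, clauses
(A1)–(A21)) and introduce the *relativized* refutation statement `RREF(F,s)` (clauses (A1)–(A24):
every clause guarded by activity literals `¬P[u]`, plus (A22)–(A24)), and prove that the
polynomial-time map `G(F) := RREF(F, 13 n²)` (`n` = number of variables of the 3-CNF `F`) sends
satisfiable `F` to CNFs with polynomially short Resolution refutations and unsatisfiable `F` to
CNFs requiring length `> 2^{r^{1/d}}` — whence automating Resolution is NP-hard.

This file defines, exactly following the clause tables of [Atserias–Müller 2020, Appendix
"Formulas REF and RREF"]: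

* `RefVar` — the variables `D[u,i,b]`, `V[u,i]`, `I[u,j]`, `L[u,v]`, `R[u,v]`, `P[u]`, and an
  injective numbering `RefVar.code : RefVar → ℕ` with left inverse `RefVar.decode`;
* `RefCNF.A1 … RefCNF.A24` — the 24 clause families, each parameterised by `rel : Bool`
  (`false` = the REF clause, `true` = the RREF clause with its `¬P[·]` guards);
* `RefCNF.ref X F s` (= `REF(F,s)`), `RefCNF.rref X F s` (= `RREF(F,s)`) `: CNF RefVar` — the
  structured formulas for a CNF `F : CNF ℕ` whose variables are listed by `X : List ℕ` (`X[k]`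
  is the paper's `X_{k+1}`);
* `refCNF F s`, `rrefCNF F s : CNF ℕ` — the same over variables `ℕ` (via `RefVar.code`), with
  `X := RefCNF.sortedVars F`, the occurring variables of `F` in increasing order, so that
  `n = |vars F|`;
* `rrefGadget F := rrefCNF F (13 n²)` — the map `G` of [Atserias–Müller 2020, §6, proof of Thm 2];
* named facts (`def … : Prop`, cited): the upper bound [AM20, Lemma 11], the lower bound
  [AM20, Lemma 10], Theorem 2 (a)+(b) of [AM20] for `rrefGadget`, polynomial-time computability
  of `G` [AM20, Thm 2], and Garlík's lower bound for the non-relativized `REF(F,s)`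
  [Garlík 2019, arXiv version Thm 26].

## Index conventions (ours ↔ paper)

All indices are 0-based: a line `u < s` is the paper's line `u+1 ∈ [s]`; a variable index
`i < n` is the paper's `X_{i+1}`, namely the variable `X[i]` of `F`; a clause index `j < m` is the
paper's `C_{j+1} = F[j]`. The paper's sentinel value `0` of `V, I, L, R` ("not a resolvent",
"not an axiom", "no premise") is `none : Option ℕ`. The last line (paper's `s`) is the `u < s`
with `u + 1 = s`, selected by a `filter`, so no natural subtraction occurs. Semantics of the
variables [AM20, §3–§4]: `D[u,i,b]` — the literal `X_i^{(b)}` (`b = true`: positive) is in line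
`D_u`; `V[u, some i]` — `D_u` is a weakening of the resolvent of `D_{L(u)} ∋ ¬X_i` and
`D_{R(u)} ∋ X_i` on `X_i`; `I[u, some j]` — `D_u` is a weakening of the clause `C_j` of `F`;
`L[u,v]`, `R[u,v]` — the premise pointers; `P[u]` (RREF only) — line `u` is active.

## Design notes

* The clause families are literal transcriptions of the table: e.g. the at-most-one families
  (A5)–(A8) range over ORDERED pairs `i ≠ i'` as printed (so each set-clause is listed twice), and
  (A15)–(A18) range over all `u, v ∈ [s]` as printed (the cases `v ≥ u` being subsumed by
  (A13)–(A14)); in RREF a clause mentioning `u = v` twice carries `¬P[u]` twice. As SETS of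
  set-clauses (`CNF.clauseFinsets`, the form Resolution operates on) these coincide with the
  paper's formulas.
* (A19) ranges over the literal occurrences of the list-clause `F[j]`; a literal `(x, b)` of `F`
  becomes `D[u, X.idxOf x, b]` (for `refCNF`/`rrefCNF`, `X.idxOf x` is the rank of `x` among the
  occurring variables). Indexing the OCCURRING variables (rather than all `x < F.numVars`) is what
  "`F` has `n` variables `X_1, …, X_n`" means and keeps `|rrefGadget F|` polynomial in the code
  length of `F` (variable numerals are binary, so `F.numVars` may be exponential in it).
* `s = 0` is excluded in the papers (`s ≥ 1`); here `RefCNF.ref X F 0 = []` and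
  `RefCNF.rref X F 0 = []` (documented junk: no line exists, every family is empty). All facts
  below assume `1 ≤ s`.
* The paper assumes the clauses of `F` non-tautological; for a tautological `F[j]` the clauses
  (A19)+(A20) merely forbid `I(u) = j`. Facts that need it carry the hypothesis
  `∀ C ∈ F.clauseFinsets, IsNonTaut C`.
* Our Resolution system (`IsResRefutation`, `Resolution.lean`) has an explicit weakening rule and
  permits tautological lines, whereas [AM20, §2] builds weakening into every inference and forbids
  tautological lines. A refutation in our sense yields one in theirs of at most the same length
  (drop tautological lines — a resolvent with a tautological premise is a weakening of the other
  premise — and compose weakenings), and conversely one of theirs of length `ℓ` yields one of ours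
  of length `≤ 2ℓ`. Hence their length LOWER bounds hold verbatim for `minResRefutationSize`, and
  their polynomial UPPER bounds hold up to a factor `2`, absorbed in the unspecified constants.
* Not formalized here: the semantic equivalence "`REF(F,s)` satisfiable iff `F` has a refutation
  of length `s`" [AM20, §4] (a definition-unfolding exercise left to users), Pudlák's explicit
  refutation of `RREF(F,s)` from a satisfying assignment (described in the docstring of
  `rrefCNF_upperBound`), the padded variant `RREF'` giving constants `c → 1`, `d → 2`
  [AM20, §7], and Garlík's levelled formula `REF^F_{s,t}` [Garlík 2019, §3] (separate file).

## References

* A. Atserias, M. Müller, *Automating Resolution is NP-hard*, J. ACM 67(5) (2020), Art. 31;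
  FOCS 2019; arXiv:1904.02991. Numbering used in the cites below is that of the arXiv version:
  §3 (refutations as structures (R1)–(R8)), §4 (REF, Lemma 4), §5 (RREF, Lemma 10 lower bound,
  Lemma 11 upper bound), §6 (proof of Thm 2: `G(F) := RREF(F,13n²)`), Appendix (clause tables).
* P. Pudlák, *On reducibility and symmetry of disjoint NP pairs*, TCS 295 (2003) 323–339
  (the formula REF(F,s); symmetry of the canonical pair of Resolution).
* M. Garlík, *Resolution lower bounds for refutation statements*, MFCS 2019, LIPIcs 138, 37;
  arXiv:1905.12372 (Thm 1; arXiv §7 "Formula REF of Atserias and Müller", Thm 26).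
-/

namespace Literature.Computability.MetaComplexity

open _root_.Computability Complexity

/-! ### The variables of `REF(F,s)` / `RREF(F,s)` and their numbering -/

/-- The propositional variables of the refutation statements `REF(F,s)` and `RREF(F,s)`
(0-based indices, `none` = the paper's sentinel `0`): `D u i b` — "the literal `X_i^{(b)}` is in
line `D_u`"; `V u i` — "`V(u) = i`" (line `u` is obtained by a cut on `X_i`; `none`: it is not a
resolvent); `I u j` — "`I(u) = j`" (line `u` is a weakening of the clause `C_j` of `F`; `none`:
it is not an axiom); `L u v` / `R u v` — "`L(u) = v`" / "`R(u) = v`" (left/right premise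
pointers; `none`: no premise); `P u` — "line `u` is active" (RREF only).
[cite: AtseriasMuller2020, §4 (variables of REF) and §5 (variable P of RREF)] -/
inductive RefVar : Type
  /-- `D[u,i,b]`: the literal `X_i^{(b)}` occurs in line `u` -/
  | D (u i : ℕ) (b : Bool) : RefVar
  /-- `V[u,i]`: the pivot of line `u` is `X_i` (`none`: line `u` is not a resolvent) -/
  | V (u : ℕ) (i : Option ℕ) : RefVar
  /-- `I[u,j]`: line `u` is a weakening of clause `C_j` of `F` (`none`: not an axiom) -/
  | I (u : ℕ) (j : Option ℕ) : RefVar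
  /-- `L[u,v]`: the left premise of line `u` is line `v` (`none`: no premise) -/
  | L (u : ℕ) (v : Option ℕ) : RefVar
  /-- `R[u,v]`: the right premise of line `u` is line `v` (`none`: no premise) -/
  | R (u : ℕ) (v : Option ℕ) : RefVar
  /-- `P[u]`: line `u` is active (only in `RREF`) -/
  | P (u : ℕ) : RefVar
  deriving DecidableEq, Repr

namespace RefVar

/-- Numbering of an optional index: `none ↦ 0`, `some k ↦ k + 1` (the paper's `{0} ∪ [n]`).
[folklore] -/
def optCode : Option ℕ → ℕ
  | none => 0
  | some k => k + 1

/-- Inverse of `optCode`. [folklore] -/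
def optDecode : ℕ → Option ℕ
  | 0 => none
  | k + 1 => some k

/-- `optDecode` inverts `optCode`. [folklore] -/
@[simp] theorem optDecode_optCode (o : Option ℕ) : optDecode (optCode o) = o := by
  cases o <;> rfl

/-- An injective numbering of the variables by naturals: the residue mod `6` is the kind of the
variable, the quotient is the line index (for `P`) or the Cantor-style pairing `Nat.pair` of the
two indices (the Boolean of `D u i b` being merged into `2 i + b`). Quadratic in the indices.
[folklore] -/
def code : RefVar → ℕ
  | P u => 6 * u
  | D u i b => 6 * Nat.pair u (2 * i + b.toNat) + 1
  | V u i => 6 * Nat.pair u (optCode i) + 2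
  | I u j => 6 * Nat.pair u (optCode j) + 3
  | L u v => 6 * Nat.pair u (optCode v) + 4
  | R u v => 6 * Nat.pair u (optCode v) + 5

/-- Decoding a natural number to a variable (a left inverse of `code`; total, with harmless
values off the image). [folklore] -/
def decode (k : ℕ) : RefVar :=
  let q := k / 6
  let u := q.unpair.1
  let w := q.unpair.2
  if k % 6 = 0 then P q
  else if k % 6 = 1 then D u (w / 2) (decide (w % 2 = 1))
  else if k % 6 = 2 then V u (optDecode w)
  else if k % 6 = 3 then I u (optDecode w)
  else if k % 6 = 4 then L u (optDecode w)
  else R u (optDecode w)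

/-- `decode` is a left inverse of `code`. [folklore] -/
@[simp] theorem decode_code (x : RefVar) : decode (code x) = x := by
  have hdiv : ∀ q r : ℕ, r < 6 → (6 * q + r) / 6 = q := fun q r hr => by omega
  have hmod : ∀ q r : ℕ, r < 6 → (6 * q + r) % 6 = r := fun q r hr => by omega
  cases x with
  | D u i b =>
    have h2 : (2 * i + b.toNat) / 2 = i := by
      cases b <;> simp only [Bool.toNat_false, Bool.toNat_true] <;> omega
    have h3 : decide ((2 * i + b.toNat) % 2 = 1) = b := by
      cases b
      · simp only [Bool.toNat_false, decide_eq_false_iff_not]; omega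
      · simp only [Bool.toNat_true, decide_eq_true_eq]; omega
    simp only [decode, code, hdiv _ 1 (by norm_num), hmod _ 1 (by norm_num), Nat.unpair_pair,
      h2, h3]
    simp
  | V u i =>
    simp only [decode, code, hdiv _ 2 (by norm_num), hmod _ 2 (by norm_num), Nat.unpair_pair,
      optDecode_optCode]
    simp
  | I u j =>
    simp only [decode, code, hdiv _ 3 (by norm_num), hmod _ 3 (by norm_num), Nat.unpair_pair,
      optDecode_optCode]
    simp
  | L u v =>
    simp only [decode, code, hdiv _ 4 (by norm_num), hmod _ 4 (by norm_num), Nat.unpair_pair,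
      optDecode_optCode]
    simp
  | R u v =>
    simp only [decode, code, hdiv _ 5 (by norm_num), hmod _ 5 (by norm_num), Nat.unpair_pair,
      optDecode_optCode]
    simp
  | P u =>
    have h1 : (6 * u) / 6 = u := by omega
    have h0 : (6 * u) % 6 = 0 := by omega
    simp [decode, code, h1, h0]

/-- The numbering of the variables is injective. [folklore] -/
theorem code_injective : Function.Injective code :=
  Function.LeftInverse.injective decode_code

end RefVar

/-! ### The clause families (A1)–(A24) -/

namespace RefCNF

/-- The guard of a clause mentioning line `u`: the literal `¬P[u]` in the relativized formula
(`rel = true`), nothing in `REF` (`rel = false`). [cite: AtseriasMuller2020, Appendix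
(Clauses of RREF: the literal ¬P(u) is added for every line index u mentioned by the clause)] -/
def pfx (rel : Bool) (u : ℕ) : Clause RefVar :=
  if rel then [(RefVar.P u, false)] else []

/-- The index range `{0} ∪ [k]` of the paper as `[none, some 0, …, some (k-1)]`. [folklore] -/
def optRange (k : ℕ) : List (Option ℕ) :=
  none :: (List.range k).map some

variable (rel : Bool)

/-- (A1) `V[u,0] ∨ V[u,1] ∨ ⋯ ∨ V[u,n]` for `u ∈ [s]`: `V(u)` is defined.
[cite: AtseriasMuller2020, Appendix, clause (A1)] -/
def A1 (s n : ℕ) : CNF RefVar :=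
  (List.range s).map fun u => pfx rel u ++ (optRange n).map fun i => (RefVar.V u i, true)

/-- (A2) `I[u,0] ∨ I[u,1] ∨ ⋯ ∨ I[u,m]` for `u ∈ [s]`: `I(u)` is defined.
[cite: AtseriasMuller2020, Appendix, clause (A2)] -/
def A2 (s m : ℕ) : CNF RefVar :=
  (List.range s).map fun u => pfx rel u ++ (optRange m).map fun j => (RefVar.I u j, true)

/-- (A3) `L[u,0] ∨ L[u,1] ∨ ⋯ ∨ L[u,s]` for `u ∈ [s]`: `L(u)` is defined.
[cite: AtseriasMuller2020, Appendix, clause (A3)] -/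
def A3 (s : ℕ) : CNF RefVar :=
  (List.range s).map fun u => pfx rel u ++ (optRange s).map fun v => (RefVar.L u v, true)

/-- (A4) `R[u,0] ∨ R[u,1] ∨ ⋯ ∨ R[u,s]` for `u ∈ [s]`: `R(u)` is defined.
[cite: AtseriasMuller2020, Appendix, clause (A4)] -/
def A4 (s : ℕ) : CNF RefVar :=
  (List.range s).map fun u => pfx rel u ++ (optRange s).map fun v => (RefVar.R u v, true)

/-- (A5) `¬V[u,i] ∨ ¬V[u,i']` for `u ∈ [s]`, `i ≠ i' ∈ {0} ∪ [n]` (ordered pairs, as printed):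
`V(u)` is single-valued. [cite: AtseriasMuller2020, Appendix, clause (A5)] -/
def A5 (s n : ℕ) : CNF RefVar :=
  (List.range s).flatMap fun u => (optRange n).flatMap fun i =>
    ((optRange n).filter (· ≠ i)).map fun i' =>
      pfx rel u ++ [(RefVar.V u i, false), (RefVar.V u i', false)]

/-- (A6) `¬I[u,j] ∨ ¬I[u,j']` for `u ∈ [s]`, `j ≠ j' ∈ {0} ∪ [m]`: `I(u)` is single-valued.
[cite: AtseriasMuller2020, Appendix, clause (A6)] -/
def A6 (s m : ℕ) : CNF RefVar :=
  (List.range s).flatMap fun u => (optRange m).flatMap fun j =>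
    ((optRange m).filter (· ≠ j)).map fun j' =>
      pfx rel u ++ [(RefVar.I u j, false), (RefVar.I u j', false)]

/-- (A7) `¬L[u,v] ∨ ¬L[u,v']` for `u ∈ [s]`, `v ≠ v' ∈ {0} ∪ [s]`: `L(u)` is single-valued.
[cite: AtseriasMuller2020, Appendix, clause (A7)] -/
def A7 (s : ℕ) : CNF RefVar :=
  (List.range s).flatMap fun u => (optRange s).flatMap fun v =>
    ((optRange s).filter (· ≠ v)).map fun v' =>
      pfx rel u ++ [(RefVar.L u v, false), (RefVar.L u v', false)]

/-- (A8) `¬R[u,v] ∨ ¬R[u,v']` for `u ∈ [s]`, `v ≠ v' ∈ {0} ∪ [s]`: `R(u)` is single-valued.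
[cite: AtseriasMuller2020, Appendix, clause (A8)] -/
def A8 (s : ℕ) : CNF RefVar :=
  (List.range s).flatMap fun u => (optRange s).flatMap fun v =>
    ((optRange s).filter (· ≠ v)).map fun v' =>
      pfx rel u ++ [(RefVar.R u v, false), (RefVar.R u v', false)]

/-- (A9) `¬I[u,0] ∨ ¬V[u,0]` for `u ∈ [s]`: not both `I(u) = 0` and `V(u) = 0` (R1).
[cite: AtseriasMuller2020, Appendix, clause (A9)] -/
def A9 (s : ℕ) : CNF RefVar :=
  (List.range s).map fun u => pfx rel u ++ [(RefVar.I u none, false), (RefVar.V u none, false)]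

/-- (A10) `I[u,0] ∨ V[u,0]` for `u ∈ [s]`: `I(u) = 0` or `V(u) = 0` (R1).
[cite: AtseriasMuller2020, Appendix, clause (A10)] -/
def A10 (s : ℕ) : CNF RefVar :=
  (List.range s).map fun u => pfx rel u ++ [(RefVar.I u none, true), (RefVar.V u none, true)]

/-- (A11) `¬I[u,0] ∨ ¬L[u,0]` for `u ∈ [s]`: a resolvent line has a left premise (R2).
[cite: AtseriasMuller2020, Appendix, clause (A11)] -/
def A11 (s : ℕ) : CNF RefVar :=
  (List.range s).map fun u => pfx rel u ++ [(RefVar.I u none, false), (RefVar.L u none, false)]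

/-- (A12) `¬I[u,0] ∨ ¬R[u,0]` for `u ∈ [s]`: a resolvent line has a right premise (R2).
[cite: AtseriasMuller2020, Appendix, clause (A12)] -/
def A12 (s : ℕ) : CNF RefVar :=
  (List.range s).map fun u => pfx rel u ++ [(RefVar.I u none, false), (RefVar.R u none, false)]

/-- (A13) `¬L[u,v]` for `u, v ∈ [s]`, `u ≤ v`: left premises are earlier lines (R3) — the
built-in linear order. [cite: AtseriasMuller2020, Appendix, clause (A13)] -/
def A13 (s : ℕ) : CNF RefVar :=
  (List.range s).flatMap fun u => ((List.range s).filter (u ≤ ·)).map fun v =>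
    pfx rel u ++ [(RefVar.L u (some v), false)]

/-- (A14) `¬R[u,v]` for `u, v ∈ [s]`, `u ≤ v`: right premises are earlier lines (R3).
[cite: AtseriasMuller2020, Appendix, clause (A14)] -/
def A14 (s : ℕ) : CNF RefVar :=
  (List.range s).flatMap fun u => ((List.range s).filter (u ≤ ·)).map fun v =>
    pfx rel u ++ [(RefVar.R u (some v), false)]

/-- (A15) `¬L[u,v] ∨ ¬V[u,i] ∨ D[v,i,0]` for `u, v ∈ [s]`, `i ∈ [n]`: the left premise of a cut
on `X_i` contains `¬X_i` (R4a). In RREF guarded by `¬P[u] ∨ ¬P[v]`.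
[cite: AtseriasMuller2020, Appendix, clause (A15)] -/
def A15 (s n : ℕ) : CNF RefVar :=
  (List.range s).flatMap fun u => (List.range s).flatMap fun v => (List.range n).map fun i =>
    pfx rel u ++ pfx rel v ++
      [(RefVar.L u (some v), false), (RefVar.V u (some i), false), (RefVar.D v i false, true)]

/-- (A16) `¬R[u,v] ∨ ¬V[u,i] ∨ D[v,i,1]` for `u, v ∈ [s]`, `i ∈ [n]`: the right premise of a
cut on `X_i` contains `X_i` (R4b). In RREF guarded by `¬P[u] ∨ ¬P[v]`.
[cite: AtseriasMuller2020, Appendix, clause (A16)] -/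
def A16 (s n : ℕ) : CNF RefVar :=
  (List.range s).flatMap fun u => (List.range s).flatMap fun v => (List.range n).map fun i =>
    pfx rel u ++ pfx rel v ++
      [(RefVar.R u (some v), false), (RefVar.V u (some i), false), (RefVar.D v i true, true)]

/-- (A17) `¬L[u,v] ∨ ¬V[u,i] ∨ ¬D[v,i',b] ∨ D[u,i',b]` for `u, v ∈ [s]`, `i ≠ i' ∈ [n]`,
`b ∈ {0,1}`: a resolvent on `X_i` keeps the other literals of its left premise (R5a). In RREF
guarded by `¬P[u] ∨ ¬P[v]`. [cite: AtseriasMuller2020, Appendix, clause (A17)] -/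
def A17 (s n : ℕ) : CNF RefVar :=
  (List.range s).flatMap fun u => (List.range s).flatMap fun v =>
    (List.range n).flatMap fun i => ((List.range n).filter (· ≠ i)).flatMap fun i' =>
      [false, true].map fun b =>
        pfx rel u ++ pfx rel v ++ [(RefVar.L u (some v), false), (RefVar.V u (some i), false),
          (RefVar.D v i' b, false), (RefVar.D u i' b, true)]

/-- (A18) `¬R[u,v] ∨ ¬V[u,i] ∨ ¬D[v,i',b] ∨ D[u,i',b]` for `u, v ∈ [s]`, `i ≠ i' ∈ [n]`,
`b ∈ {0,1}`: a resolvent on `X_i` keeps the other literals of its right premise (R5b). In RREF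
guarded by `¬P[u] ∨ ¬P[v]`. [cite: AtseriasMuller2020, Appendix, clause (A18)] -/
def A18 (s n : ℕ) : CNF RefVar :=
  (List.range s).flatMap fun u => (List.range s).flatMap fun v =>
    (List.range n).flatMap fun i => ((List.range n).filter (· ≠ i)).flatMap fun i' =>
      [false, true].map fun b =>
        pfx rel u ++ pfx rel v ++ [(RefVar.R u (some v), false), (RefVar.V u (some i), false),
          (RefVar.D v i' b, false), (RefVar.D u i' b, true)]

/-- (A19) `¬I[u,j] ∨ D[u,i,b]` for `u ∈ [s]`, `j ∈ [m]` and every literal `X_i^{(b)} ∈ C_j`: an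
axiom line contains its clause of `F` (R6). Here `C_j = F[j]`, and a literal `(x, b)` of `F` is
the paper's `X_i^{(b)}` for `i = X.idxOf x`, its position in the variable list `X`.
[cite: AtseriasMuller2020, Appendix, clause (A19)] -/
def A19 (X : List ℕ) (F : CNF ℕ) (s : ℕ) : CNF RefVar :=
  (List.range s).flatMap fun u => (List.range F.length).flatMap fun j =>
    (F.getD j []).map fun l =>
      pfx rel u ++ [(RefVar.I u (some j), false), (RefVar.D u (X.idxOf l.1) l.2, true)]

/-- (A20) `¬D[u,i,0] ∨ ¬D[u,i,1]` for `u ∈ [s]`, `i ∈ [n]`: no line is tautological (R7).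
[cite: AtseriasMuller2020, Appendix, clause (A20)] -/
def A20 (s n : ℕ) : CNF RefVar :=
  (List.range s).flatMap fun u => (List.range n).map fun i =>
    pfx rel u ++ [(RefVar.D u i false, false), (RefVar.D u i true, false)]

/-- (A21) `¬D[s,i,b]` for `i ∈ [n]`, `b ∈ {0,1}`: the last line is the empty clause (R8)
(the last line is the `u < s` with `u + 1 = s`; no clause when `s = 0`).
[cite: AtseriasMuller2020, Appendix, clause (A21)] -/
def A21 (s n : ℕ) : CNF RefVar :=
  ((List.range s).filter (· + 1 = s)).flatMap fun u => (List.range n).flatMap fun i =>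
    [false, true].map fun b => pfx rel u ++ [(RefVar.D u i b, false)]

/-- (A22) `¬P[u] ∨ ¬L[u,v] ∨ P[v]` for `u, v ∈ [s]` (RREF only): premises of active lines are
active. [cite: AtseriasMuller2020, Appendix, clause (A22)] -/
def A22 (s : ℕ) : CNF RefVar :=
  (List.range s).flatMap fun u => (List.range s).map fun v =>
    [(RefVar.P u, false), (RefVar.L u (some v), false), (RefVar.P v, true)]

/-- (A23) `¬P[u] ∨ ¬R[u,v] ∨ P[v]` for `u, v ∈ [s]` (RREF only): premises of active lines are
active. [cite: AtseriasMuller2020, Appendix, clause (A23)] -/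
def A23 (s : ℕ) : CNF RefVar :=
  (List.range s).flatMap fun u => (List.range s).map fun v =>
    [(RefVar.P u, false), (RefVar.R u (some v), false), (RefVar.P v, true)]

/-- (A24) `P[s]` (RREF only): the last line is active (no clause when `s = 0`).
[cite: AtseriasMuller2020, Appendix, clause (A24)] -/
def A24 (s : ℕ) : CNF RefVar :=
  ((List.range s).filter (· + 1 = s)).map fun u => [(RefVar.P u, true)]

/-- The clauses (A1)–(A21), plain (`rel = false`, the clauses of `REF(F,s)`) or guarded
(`rel = true`, the first 21 families of `RREF(F,s)`), for `F` with variable list `X`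
(`n := |X|`, `m := |F|`) and `s` lines. [cite: AtseriasMuller2020, Appendix (Clauses of REF)] -/
def blocks (X : List ℕ) (F : CNF ℕ) (s : ℕ) : CNF RefVar :=
  A1 rel s X.length ++ A2 rel s F.length ++ A3 rel s ++ A4 rel s ++
  A5 rel s X.length ++ A6 rel s F.length ++ A7 rel s ++ A8 rel s ++
  A9 rel s ++ A10 rel s ++ A11 rel s ++ A12 rel s ++ A13 rel s ++ A14 rel s ++
  A15 rel s X.length ++ A16 rel s X.length ++ A17 rel s X.length ++ A18 rel s X.length ++
  A19 rel X F s ++ A20 rel s X.length ++ A21 rel s X.length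

/-- The occurring variables of a CNF over `ℕ` in increasing order: the list `X_1 < ⋯ < X_n` of
"the `n` variables of `F`". (The same list as `SharpSATVerif.sortedVars` of
`Complexity/SharpSATMembership.lean`, not imported to keep this file's dependencies light.)
[folklore] -/
def sortedVars (F : CNF ℕ) : List ℕ :=
  (CNF.vars F).sort (· ≤ ·)

/-- Renumbering a CNF over `RefVar` into a CNF over `ℕ` along `RefVar.code`. [folklore] -/
def toNat (φ : CNF RefVar) : CNF ℕ :=
  φ.map fun C => C.map fun l => (l.1.code, l.2)

end RefCNF

/-! ### `RefCNF.ref` = `REF(F,s)`, `RefCNF.rref` = `RREF(F,s)`, and the versions over `ℕ` -/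

/-- Pudlák's refutation statement `REF(F,s)` in the clause form of Atserias–Müller: the CNF over
`RefVar` consisting of the clauses (A1)–(A21), for the CNF `F` with variable list `X` and `s`
lines; its satisfying assignments describe exactly the Resolution refutations of `F` of length
`s` (structures `(D,V,I,L,R)` satisfying (R1)–(R8)). [cite: AtseriasMuller2020, §4 and Appendix
(Clauses of REF); Pudlák 2003 (REF(F,s))] -/
def RefCNF.ref (X : List ℕ) (F : CNF ℕ) (s : ℕ) : CNF RefVar :=
  RefCNF.blocks false X F s

/-- The relativized refutation statement `RREF(F,s)` of Atserias–Müller: the clauses (A1)–(A21)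
each guarded by `¬P[u]` for the line indices `u` it mentions, together with (A22)–(A24); it
says that the lines with active indices (`P[u]`) describe a Resolution refutation of `F` ending
at the (active) line `s`. [cite: AtseriasMuller2020, §5 and Appendix (Clauses of RREF)] -/
def RefCNF.rref (X : List ℕ) (F : CNF ℕ) (s : ℕ) : CNF RefVar :=
  RefCNF.blocks true X F s ++ RefCNF.A22 s ++ RefCNF.A23 s ++ RefCNF.A24 s

/-- `refCNF F s = REF(F,s)` as a CNF over variables `ℕ`: the variables of `F` are its occurring
variables in increasing order (`RefCNF.sortedVars F`, so `n = |vars F|`), and the variables of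
`REF` are numbered by `RefVar.code`. [cite: AtseriasMuller2020, §4 (REF(F,s))] -/
def refCNF (F : CNF ℕ) (s : ℕ) : CNF ℕ :=
  RefCNF.toNat (RefCNF.ref (RefCNF.sortedVars F) F s)

/-- `rrefCNF F s = RREF(F,s)` as a CNF over variables `ℕ` (conventions as for `refCNF`).
[cite: AtseriasMuller2020, §5 (RREF(F,s))] -/
def rrefCNF (F : CNF ℕ) (s : ℕ) : CNF ℕ :=
  RefCNF.toNat (RefCNF.rref (RefCNF.sortedVars F) F s)

/-- The Atserias–Müller gadget `G(F) := RREF(F, 13 n²)`, where `n = |vars F|` is the number of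
variables of `F`. [cite: AtseriasMuller2020, §6, proof of Thm 2 ("We set G(F) := RREF(F,13n²)")]
-/
def rrefGadget (F : CNF ℕ) : CNF ℕ :=
  rrefCNF F (13 * (CNF.vars F).card ^ 2)

/-! ### Unfolding and transport lemmas -/

/-- `RefCNF.ref` is the unguarded block list. [cite: AtseriasMuller2020, Appendix] -/
theorem RefCNF.ref_eq (X : List ℕ) (F : CNF ℕ) (s : ℕ) :
    RefCNF.ref X F s = RefCNF.blocks false X F s := rfl

/-- `RefCNF.rref` is the guarded block list followed by (A22)–(A24).
[cite: AtseriasMuller2020, Appendix] -/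
theorem RefCNF.rref_eq (X : List ℕ) (F : CNF ℕ) (s : ℕ) :
    RefCNF.rref X F s =
      RefCNF.blocks true X F s ++ RefCNF.A22 s ++ RefCNF.A23 s ++ RefCNF.A24 s := rfl

/-- Unfolding `refCNF`. [cite: AtseriasMuller2020, §4] -/
theorem refCNF_eq (F : CNF ℕ) (s : ℕ) :
    refCNF F s = RefCNF.toNat (RefCNF.ref (RefCNF.sortedVars F) F s) := rfl

/-- Unfolding `rrefCNF`. [cite: AtseriasMuller2020, §5] -/
theorem rrefCNF_eq (F : CNF ℕ) (s : ℕ) :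
    rrefCNF F s = RefCNF.toNat (RefCNF.rref (RefCNF.sortedVars F) F s) := rfl

/-- Unfolding `rrefGadget`. [cite: AtseriasMuller2020, §6] -/
theorem rrefGadget_eq (F : CNF ℕ) : rrefGadget F = rrefCNF F (13 * (CNF.vars F).card ^ 2) := rfl

/-- With no lines (`s = 0`, excluded in the paper) every clause family is empty:
`RefCNF.ref X F 0 = []` (documented junk value). [folklore] -/
theorem RefCNF.ref_zero (X : List ℕ) (F : CNF ℕ) : RefCNF.ref X F 0 = [] := by
  simp [RefCNF.ref, RefCNF.blocks, RefCNF.A1, RefCNF.A2, RefCNF.A3, RefCNF.A4, RefCNF.A5,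
    RefCNF.A6, RefCNF.A7, RefCNF.A8, RefCNF.A9, RefCNF.A10, RefCNF.A11, RefCNF.A12, RefCNF.A13,
    RefCNF.A14, RefCNF.A15, RefCNF.A16, RefCNF.A17, RefCNF.A18, RefCNF.A19, RefCNF.A20,
    RefCNF.A21]

/-- Likewise `RefCNF.rref X F 0 = []`. [folklore] -/
theorem RefCNF.rref_zero (X : List ℕ) (F : CNF ℕ) : RefCNF.rref X F 0 = [] := by
  rw [RefCNF.rref_eq, ← RefCNF.ref_zero X F, RefCNF.ref_eq]
  simp [RefCNF.blocks, RefCNF.A1, RefCNF.A2, RefCNF.A3, RefCNF.A4, RefCNF.A5, RefCNF.A6,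
    RefCNF.A7, RefCNF.A8, RefCNF.A9, RefCNF.A10, RefCNF.A11, RefCNF.A12, RefCNF.A13, RefCNF.A14,
    RefCNF.A15, RefCNF.A16, RefCNF.A17, RefCNF.A18, RefCNF.A19, RefCNF.A20, RefCNF.A21,
    RefCNF.A22, RefCNF.A23, RefCNF.A24]

/-- `refCNF F 0 = []` and `rrefCNF F 0 = []` (junk at the excluded value `s = 0`). [folklore] -/
theorem refCNF_zero (F : CNF ℕ) : refCNF F 0 = [] ∧ rrefCNF F 0 = [] := by
  simp [refCNF, rrefCNF, RefCNF.ref_zero, RefCNF.rref_zero, RefCNF.toNat]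

/-- The occurring variables listed by `sortedVars` are exactly `vars F`. [folklore] -/
@[simp] theorem RefCNF.mem_sortedVars {F : CNF ℕ} {x : ℕ} :
    x ∈ RefCNF.sortedVars F ↔ x ∈ CNF.vars F := by
  simp [RefCNF.sortedVars]

/-- `sortedVars F` has `n = |vars F|` entries. [folklore] -/
theorem RefCNF.length_sortedVars (F : CNF ℕ) :
    (RefCNF.sortedVars F).length = (CNF.vars F).card := by
  simp [RefCNF.sortedVars]

/-- Renumbering the variables along the injective `RefVar.code` preserves the value under the
transported assignment. [folklore] -/
theorem RefCNF.eval_toNat (φ : CNF RefVar) (σ : ℕ → Bool) :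
    (RefCNF.toNat φ).eval σ = φ.eval (fun x => σ x.code) := by
  induction φ with
  | nil => rfl
  | cons C φ ih =>
    simp only [RefCNF.toNat, List.map_cons, CNF.eval_cons] at ih ⊢
    rw [ih]
    congr 1
    simp only [Clause.eval, List.any_map]
    congr 1

/-- Renumbering along `RefVar.code` preserves satisfiability (both directions, since `code` has
the left inverse `decode`). [folklore] -/
theorem RefCNF.satisfiable_toNat_iff (φ : CNF RefVar) :
    (RefCNF.toNat φ).Satisfiable ↔ φ.Satisfiable := by
  constructor
  · rintro ⟨σ, hσ⟩
    exact ⟨fun x => σ x.code, by rwa [RefCNF.eval_toNat] at hσ⟩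
  · rintro ⟨τ, hτ⟩
    refine ⟨fun k => τ (RefVar.decode k), ?_⟩
    rw [RefCNF.eval_toNat]
    simpa using hτ

/-- Clause counts are preserved by the renumbering. [folklore] -/
@[simp] theorem RefCNF.length_toNat (φ : CNF RefVar) : (RefCNF.toNat φ).length = φ.length :=
  List.length_map _

/-! ### Named facts: the Atserias–Müller bounds and hardness theorem, Garlík's lower bound -/

/-- **Upper bound** [Atserias–Müller 2020, Lemma 11]: there is a polynomial `p(s,n,m)`, in fact
`O((snm)²)`, such that for all `n, m, s ≥ 1` and every satisfiable CNF `F` with `n` variables and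
`m` clauses, `RREF(F,s)` has a Resolution refutation of length `≤ p(s,n,m)`. The refutation is
Pudlák's: from a satisfying assignment `α` derive
`True(u) := ¬P[u] ∨ D[u,1,α(X_1)] ∨ ⋯ ∨ D[u,n,α(X_n)]` for `u = 1, …, s` in order (a true literal
in every active line), then cut with (A21) and (A24). Stated for `rrefCNF` (so `n = |vars F|`)
and our `minResRefutationSize` (explicit weakening lines cost a factor `≤ 2`, absorbed in `c`).
[cite: AtseriasMuller2020, Lemma 11 (arXiv numbering; the upper-bound lemma of §5)] -/
def rrefCNF_upperBound : Prop :=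
  ∃ c : ℕ, ∀ (F : CNF ℕ) (s : ℕ), 1 ≤ s → 1 ≤ (CNF.vars F).card → 1 ≤ F.length →
    F.Satisfiable →
      minResRefutationSize (rrefCNF F s) ≤ ((c * (s * (CNF.vars F).card * F.length) ^ 2 : ℕ) : ℕ∞)

/-- **Lower bound** [Atserias–Müller 2020, Lemma 10]: there is `n₀` such that for all `n ≥ n₀`
and `20 ≤ w ≤ 2ⁿ/(13n)` and every unsatisfiable CNF `F` with `n` variables (and non-tautological
clauses, the standing assumption of [AM20, §4]), every Resolution refutation of `RREF(F, 13nw)`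
has length `> 2^{2w/5}`. Stated for `rrefCNF` (`n = |vars F|`); length lower bounds transfer to
our Resolution system verbatim (see the module docstring).
[cite: AtseriasMuller2020, Lemma 10 (arXiv numbering; the lower-bound lemma of §5)] -/
def rrefCNF_lowerBound : Prop :=
  ∃ n₀ : ℕ, ∀ (n w : ℕ) (F : CNF ℕ), n₀ ≤ n → 20 ≤ w → 13 * n * w ≤ 2 ^ n →
    (CNF.vars F).card = n → (∀ C ∈ F.clauseFinsets, IsNonTaut C) → ¬ F.Satisfiable →
      ∀ π : List (ResLine ℕ), IsResRefutation (rrefCNF F (13 * n * w)) π →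
        (2 : ℝ) ^ ((2 : ℝ) * w / 5) < π.length

/-- **Hardness of approximating minimal Resolution length** [Atserias–Müller 2020, Thm 2 (a)+(b)],
pinned to the gadget of its proof `G(F) = RREF(F, 13n²)` = `rrefGadget F`: there are reals
`c, d > 0` and a threshold `n₀` such that for every 3-CNF `F` with `n ≥ n₀` variables
(non-tautological clauses, `m ≤ 8n³` clauses — automatic for 3-CNFs given as sets of
set-clauses, [AM20, §6] "Note m ≤ 8n³"), writing `r` for the size of `G(F)`:
(a) if `F` is satisfiable then `G(F)` has a Resolution refutation of length `< r^c`;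
(b) if `F` is unsatisfiable then every Resolution refutation of `G(F)` has length `> 2^{r^{1/d}}`.
(The refinement "`c, d` arbitrarily close to `1, 2`" of [AM20, §7] uses the variant `RREF'`
without (A7)–(A8) and is not stated here.)
[cite: AtseriasMuller2020, Thm 2 (a)+(b) with §6 (proof: G(F) := RREF(F,13n²))] -/
def rrefGadget_hardness : Prop :=
  ∃ c d : ℝ, 0 < c ∧ 0 < d ∧ ∃ n₀ : ℕ, ∀ F : CNF ℕ,
    F.IsWidthLE 3 → (∀ C ∈ F.clauseFinsets, IsNonTaut C) →
    F.length ≤ 8 * (CNF.vars F).card ^ 3 → n₀ ≤ (CNF.vars F).card →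
      (F.Satisfiable → ∃ π : List (ResLine ℕ), IsResRefutation (rrefGadget F) π ∧
        (π.length : ℝ) < ((rrefGadget F).size : ℝ) ^ c) ∧
      (¬ F.Satisfiable → ∀ π : List (ResLine ℕ), IsResRefutation (rrefGadget F) π →
        (2 : ℝ) ^ (((rrefGadget F).size : ℝ) ^ (1 / d)) < π.length)

/-- **`G` is polynomial-time computable** [Atserias–Müller 2020, Thm 2 ("a polynomial-time
computable function G")]: the string map `enc F ↦ enc (rrefGadget F)` (codes of CNFs via
`encodingCNF`; arbitrary off codewords) is in `FP`. A routine machine construction: sort the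
occurring variables, then write the clause families (A1)–(A24) for `s = 13n²`, each index being
polynomial in the code length of `F` since `n = |vars F| ≤ |enc F|`.
[cite: AtseriasMuller2020, Thm 2 (G polynomial-time computable), §6] -/
def rrefGadget_polyTime : Prop :=
  ∃ f ∈ FP, ∀ F : CNF ℕ, f (encodingCNF.encode F) = encodingCNF.encode (rrefGadget F)

/-- **Garlík's lower bound for the non-relativized `REF(F,s)`** [Garlík 2019; arXiv:1905.12372,
§7, Thm 26], answering the question of [AM20, §7]: for each `ε > 0` there are `δ > 0` and `t₀`
such that if `r ≥ n ≥ 2`, `⌊s/(n+1)⌋ ≥ r^{3+ε}`, `⌊s/(n+1)⌋ ≥ t₀`, and `F` is an unsatisfiable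
CNF consisting of `r` (non-tautological) clauses in `n` variables, then every Resolution
refutation of `REF(F,s)` has length `> 2^{⌊s/(n+1)⌋^δ}`. Stated for `refCNF` (`n = |vars F|`,
`r = |F|`). (The MFCS version states the levelled variant, Thm 1; Thm 26 is the transfer to the
Atserias–Müller formula in the arXiv version's appendix.)
[cite: Garlik2019, Thm 1 and arXiv:1905.12372 §7 Thm 26 (formula REF of Atserias–Müller)] -/
def refCNF_lowerBound_Garlik : Prop :=
  ∀ ε : ℝ, 0 < ε → ∃ δ : ℝ, 0 < δ ∧ ∃ t₀ : ℕ, ∀ (F : CNF ℕ) (s : ℕ),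
    2 ≤ (CNF.vars F).card → (CNF.vars F).card ≤ F.length →
    ((F.length : ℝ)) ^ (3 + ε) ≤ ((s / ((CNF.vars F).card + 1) : ℕ) : ℝ) →
    t₀ ≤ s / ((CNF.vars F).card + 1) →
    (∀ C ∈ F.clauseFinsets, IsNonTaut C) → ¬ F.Satisfiable →
      ∀ π : List (ResLine ℕ), IsResRefutation (refCNF F s) π →
        (2 : ℝ) ^ (((s / ((CNF.vars F).card + 1) : ℕ) : ℝ) ^ δ) < π.length

end Literature.Computability.MetaComplexity
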